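import Summits.HodgeConjecture.HodgeConjecture.Theorems.SiegelUniversalFamilyHodgeFrames
import Literature.AlgebraicGeometry.HodgeTheory.HodgeFramesOfChartBallFramesAlgebraicChart
import HarnessLib

/-!
# Griffiths frames for the universal family over the Siegel fine moduli scheme — the chart pinned to
# the holomorphic algebraic chart at the centre

Cell hodgecm-mathlib (D-0151), rung 0 of the Mumford line under `HDel` (item `stmt-HodgeConjecture-24835`),
U-DAG node U-e P4, seam (S-5) of the P4 lead's PLAN v0.6 (B-p03 (g13), 2026-08-29). HC_CM is proved only
modulo the 7 printed citations until rung 0 closes; nothing in this file changes that count (a (U)-road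
helper, books 0).

The head `UnivFamilyHodgeFrames.exists_hodgeFrames_familyPullback_univFamilyℂ` of
`SiegelUniversalFamilyHodgeFrames` (★ p712353) gives, near every point `t₁` of a smooth pure-dimensional
open piece `S'` of `M ⊗ ℂ`, Hodge frames of the restricted universal family whose coordinates are
holomorphic on `ψ(W)` for SOME chart `ψ : S'(ℂ) ⇀ ℂ^d` of the univ-subtype — the existential inherited from
the named statement `Griffiths1968_holomorphicHodgeSubbundlesQP`. The period map of U-e P4 must be
holomorphic in EVERY holomorphic algebraic chart `ComplexPoints.algebraicChart (M ⊗ ℂ) d x`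
(`UHead.Ue_P4_localHolomorphicPeriodMap`), which a bare homeomorphism chart cannot give. This file re-runs
the head over the pinned Griffiths theorem `griffiths1968_holomorphicHodgeSubbundlesQP_algebraicChart`
(`HodgeTheory/HodgeFramesOfChartBallFramesAlgebraicChart`): the SAME conclusion plus the conjunct

  `ψ = (Homeomorph.Set.univ (ComplexPoints S')).transOpenPartialHomeomorph (ComplexPoints.algebraicChart S' d t₁.1)`,

after which `Motives/AlgebraicChartAnalyticTransfer` reads the coordinates in every algebraic chart.

* `exists_hodgeFrames_familyPullback_univFamilyℂ_algebraicChart` — the pinned head (same binders as the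
  ★ head; proof = its proof with the pinned Griffiths theorem in place of the named Prop's `_holds`);
* `exists_hodgeFrames_univFamilyℂ_algebraicChart` — the same for `univFamilyℂ 𝓜` ITSELF when `M ⊗ ℂ` is smooth
  of pure dimension `d` (no open piece, no `familyPullback`: fibres are `fiberOver (univFamilyℂ 𝓜) t` on the nose),
  with its binders inhabited by `isCohomologicallyLocallyTrivialOn_univFamilyℂ` and
  `exists_isHodgeSymmetric_hodgeModel_fiberOver_univFamilyℂ`.

## References

* [Griffiths1968PeriodsII] P. Griffiths, Periods of integrals on algebraic manifolds II, Amer. J. Math. 90 (1968),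
  Thm. 1.1.
* [VoisinHodgeI2002] C. Voisin, Hodge Theory and Complex Algebraic Geometry I, CUP (2002), §10.2.1 Thm. 10.3.
* [MumfordFogartyKirwan1994] D. Mumford, J. Fogarty, F. Kirwan, Geometric Invariant Theory (3rd ed.), Ch. 7 §3
  Thm. 7.9 (p. 139) and Appendix 7A (p. 235).
* [SerreGAGA1956] J.-P. Serre, Géométrie algébrique et géométrie analytique, Ann. Inst. Fourier 6 (1956), §2 n°5
  Prop. 2.
-/

set_option autoImplicit false

-- mandated namespace `Summit.HodgeConjecture.HodgeConjecture.Theorems` trips `linter.dupNamespace` (single-problem summit; the lakefile turns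
-- the linter off tree-wide as a weak option), restated here so stand-alone elaboration is warning-free (as in ★ `SiegelUniversalFamilyHodgeFrames`).
set_option linter.dupNamespace false

noncomputable section

open CategoryTheory CategoryTheory.Limits AlgebraicGeometry
open _root_.Topology _root_.Filter
open scoped TensorProduct

namespace Summit.HodgeConjecture.HodgeConjecture.Theorems

namespace UnivFamilyHodgeFrames

open Literature.AlgebraicGeometry
open Literature.AlgebraicGeometry.Motives
open Literature.AlgebraicGeometry.HodgeTheory
open Literature.AlgebraicGeometry.AbelianSchemes (PolarizedAbelianSchemeWithLevel)
open Literature.AlgebraicGeometry.ModuliOfAbelianVarieties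
open Literature.AlgebraicGeometry.ModuliOfAbelianVarieties.W1
open Literature.AlgebraicTopology.SingularHomology

variable {g N : ℕ} {δ : Fin g → ℕ} (𝓜 : SiegelFineModuliScheme g N δ)

/-- **Griffiths' theorem for the universal family over the Siegel fine moduli scheme, chart PINNED** (Voisin I
Thm. 10.3 / Griffiths 1968 Thm. 1.1, via `griffiths1968_holomorphicHodgeSubbundlesQP_algebraicChart`). Same setting
and same conclusion as ★ `exists_hodgeFrames_familyPullback_univFamilyℂ` — `𝓜` a Siegel fine moduli scheme with `M`
and the universal total space quasi-projective over `ℚ` ((F-c′)/(F-c″)), `ι : S' → M ⊗ ℂ` an open piece smooth of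
pure dimension `d`, `f := familyPullback.snd (univFamilyℂ 𝓜) ι`, any `k`, `hU`, Hodge-symmetric models `A t`, base
point `s`, point `t₁`, neighbourhood `N`: a path-connected open `W ∋ t₁`, `W ⊆ N`, inside a chart `ψ` of `S'(ℂ)` on
which the Hodge filtration steps along flat continuation are framed by linearly independent vectors with
coordinates holomorphic on `ψ(W)` — PLUS the conjunct that `ψ` IS the holomorphic algebraic chart at `t₁`,
`(Homeomorph.Set.univ _).transOpenPartialHomeomorph (ComplexPoints.algebraicChart S' d t₁.1)`, a chart of the `C^ω`
atlas `isManifold_algebraicChart S' d` (so `Motives/AlgebraicChartAnalyticTransfer` reads the coordinates in every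
algebraic chart of `S'(ℂ)`). No uniformisation input is used.
[cite: VoisinHodgeI2002, §10.2.1 Thm. 10.3 and §9.2.1] [cite: Griffiths1968PeriodsII, Thm. 1.1]
[cite: MumfordFogartyKirwan1994, Ch. 7 §3 Theorem 7.9 (p. 139) and Appendix to Ch. 7 §A (p. 235)]
[cite: SerreGAGA1956, §2 n°5 Prop. 2] -/
theorem exists_hodgeFrames_familyPullback_univFamilyℂ_algebraicChart (hMq : IsQuasiProjectiveOver 𝓜.M)
    (hXq : IsQuasiProjectiveOver (univTotal 𝓜)) {S' : SchemeOver ℂ} (ι : S' ⟶ (Motives.baseChange ℚ ℂ).obj 𝓜.M)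
    [IsOpenImmersion ι.left] (d : ℕ) [AlgebraicGeometry.SmoothOfRelativeDimension d S'.hom] (k : ℕ)
    (hU : IsCohomologicallyLocallyTrivialOn (familyPullback.snd (univFamilyℂ 𝓜) ι)
      (Set.univ : Set (ComplexPoints S')))
    (A : ∀ t : ComplexPoints S', HodgeModel g (fiberOver (familyPullback.snd (univFamilyℂ 𝓜) ι) t))
    (hA : ∀ t, (A t).IsHodgeSymmetric)
    (s t₁ : (Set.univ : Set (ComplexPoints S'))) (N : Set (Set.univ : Set (ComplexPoints S'))) (hN : N ∈ 𝓝 t₁) :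
    letI : AlgebraicGeometry.Smooth S'.hom := AlgebraicGeometry.SmoothOfRelativeDimension.smooth d _
    letI : AlgebraicGeometry.LocallyOfFiniteType S'.hom := inferInstance
    ∃ W : Set (Set.univ : Set (ComplexPoints S')), IsOpen W ∧ t₁ ∈ W ∧ W ⊆ N ∧ IsPathConnected W ∧
    ∃ ψ : OpenPartialHomeomorph (Set.univ : Set (ComplexPoints S')) (Fin d → ℂ),
      W ⊆ ψ.source ∧
      ψ = (Homeomorph.Set.univ (ComplexPoints S')).transOpenPartialHomeomorph
        (ComplexPoints.algebraicChart S' d t₁.1) ∧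
    ∀ (T₁ : singularCohomology ℚ ℚ (ComplexPoints (fiberOver (familyPullback.snd (univFamilyℂ 𝓜) ι) s.1)) k ≃ₗ[ℚ]
        singularCohomology ℚ ℚ (ComplexPoints (fiberOver (familyPullback.snd (univFamilyℂ 𝓜) ι) t₁.1)) k),
      (∃ δ₁ : Path.Homotopic.Quotient s t₁,
        ∀ v, ofRatClass _ k (T₁ v) =
          transportFun (familyPullback.snd (univFamilyℂ 𝓜) ι) k hU δ₁ (ofRatClass _ k v)) →
      ∀ p : ℤ, ∃ (r : ℕ)
        (w : Fin r → Set.Elem (Set.univ : Set (ComplexPoints S')) →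
          ℂ ⊗[ℚ] singularCohomology ℚ ℚ
            (ComplexPoints (fiberOver (familyPullback.snd (univFamilyℂ 𝓜) ι) s.1)) k),
        (∀ t ∈ W, ∀ (ε : Path t₁ t), (∀ r', ε r' ∈ W) →
          ∀ (T : singularCohomology ℚ ℚ
              (ComplexPoints (fiberOver (familyPullback.snd (univFamilyℂ 𝓜) ι) s.1)) k ≃ₗ[ℚ]
            singularCohomology ℚ ℚ
              (ComplexPoints (fiberOver (familyPullback.snd (univFamilyℂ 𝓜) ι) t.1)) k),
          (∀ v, ofRatClass _ k (T v) =
            transportFun (familyPullback.snd (univFamilyℂ 𝓜) ι) k hU ⟦ε⟧ (ofRatClass _ k (T₁ v))) →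
          LinearIndependent ℂ (fun i ↦ w i t) ∧
            (((A t.1).hodgeStructure
                ((isSmoothProjectiveFamily_familyPullback_univFamilyℂ 𝓜 ι).isSmoothProjective t.1)
                (hA t.1) k).comapEquiv T).F p =
              Submodule.span ℂ (Set.range fun i ↦ w i t)) ∧
        (∀ (i : Fin r)
          (φ : Module.Dual ℂ (ℂ ⊗[ℚ] singularCohomology ℚ ℚ
            (ComplexPoints (fiberOver (familyPullback.snd (univFamilyℂ 𝓜) ι) s.1)) k)),
          AnalyticOnNhd ℂ (fun z ↦ φ (w i (ψ.symm z))) (ψ '' W)) := by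
  have hf := isSmoothProjectiveFamily_familyPullback_univFamilyℂ 𝓜 ι
  have hS' : IsQuasiProjectiveOver S' := isQuasiProjectiveOver_of_isOpenImmersion_M 𝓜 hMq ι
  have hX' : IsQuasiProjectiveOver (familyPullback (univFamilyℂ 𝓜) ι) :=
    isQuasiProjectiveOver_familyPullback_univFamilyℂ 𝓜 hXq ι
  exact griffiths1968_holomorphicHodgeSubbundlesQP_algebraicChart (familyPullback.snd (univFamilyℂ 𝓜) ι) k
    hf hS' hX' hU A hA s t₁ N hN

/-! ### The same, for the complexified universal family itself (no open piece; `M ⊗ ℂ` smooth of pure dimension `d`) -/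

/-- **Griffiths' theorem for the complexified universal family `univFamilyℂ 𝓜 : X ⊗ ℂ → M ⊗ ℂ` ITSELF, chart
PINNED** — the case «`M ⊗ ℂ` smooth of pure dimension `d`» (the hypothesis of `UHead.Ue_P4_localHolomorphicPeriodMap`),
with no open piece `ι` and hence no `familyPullback`: every fibre is literally `fiberOver (univFamilyℂ 𝓜) t` (the
currency of `W1.fiberUnivIsoOfIsBaseChangeVia` and of the flat frames of U-e P4), and the chart is
`ComplexPoints.algebraicChart (M ⊗ ℂ) d t₁.1` on the univ-subtype. Inputs: ★ `isSmoothProjectiveFamily_univFamilyℂ_of_classify`,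
`isQuasiProjectiveOver_baseChange_M`, `IsQuasiProjectiveOver.baseChangeHom` for `X ⊗ ℂ`, and the pinned Griffiths theorem.
[cite: VoisinHodgeI2002, §10.2.1 Thm. 10.3 and §9.2.1] [cite: Griffiths1968PeriodsII, Thm. 1.1]
[cite: MumfordFogartyKirwan1994, Ch. 7 §3 Theorem 7.9 (p. 139) and Appendix to Ch. 7 §A (p. 235)]
[cite: SerreGAGA1956, §2 n°5 Prop. 2] -/
theorem exists_hodgeFrames_univFamilyℂ_algebraicChart (hMq : IsQuasiProjectiveOver 𝓜.M)
    (hXq : IsQuasiProjectiveOver (univTotal 𝓜)) (d : ℕ)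
    [AlgebraicGeometry.SmoothOfRelativeDimension d ((Motives.baseChange ℚ ℂ).obj 𝓜.M).hom] (k : ℕ)
    (hU : IsCohomologicallyLocallyTrivialOn (univFamilyℂ 𝓜)
      (Set.univ : Set (ComplexPoints ((Motives.baseChange ℚ ℂ).obj 𝓜.M))))
    (A : ∀ t : ComplexPoints ((Motives.baseChange ℚ ℂ).obj 𝓜.M), HodgeModel g (fiberOver (univFamilyℂ 𝓜) t))
    (hA : ∀ t, (A t).IsHodgeSymmetric)
    (s t₁ : (Set.univ : Set (ComplexPoints ((Motives.baseChange ℚ ℂ).obj 𝓜.M))))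
    (N : Set (Set.univ : Set (ComplexPoints ((Motives.baseChange ℚ ℂ).obj 𝓜.M)))) (hN : N ∈ 𝓝 t₁) :
    letI : AlgebraicGeometry.Smooth ((Motives.baseChange ℚ ℂ).obj 𝓜.M).hom :=
      AlgebraicGeometry.SmoothOfRelativeDimension.smooth d _
    letI : AlgebraicGeometry.LocallyOfFiniteType ((Motives.baseChange ℚ ℂ).obj 𝓜.M).hom := inferInstance
    ∃ W : Set (Set.univ : Set (ComplexPoints ((Motives.baseChange ℚ ℂ).obj 𝓜.M))),
      IsOpen W ∧ t₁ ∈ W ∧ W ⊆ N ∧ IsPathConnected W ∧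
    ∃ ψ : OpenPartialHomeomorph (Set.univ : Set (ComplexPoints ((Motives.baseChange ℚ ℂ).obj 𝓜.M))) (Fin d → ℂ),
      W ⊆ ψ.source ∧
      ψ = (Homeomorph.Set.univ (ComplexPoints ((Motives.baseChange ℚ ℂ).obj 𝓜.M))).transOpenPartialHomeomorph
        (ComplexPoints.algebraicChart ((Motives.baseChange ℚ ℂ).obj 𝓜.M) d t₁.1) ∧
    ∀ (T₁ : singularCohomology ℚ ℚ (ComplexPoints (fiberOver (univFamilyℂ 𝓜) s.1)) k ≃ₗ[ℚ]
        singularCohomology ℚ ℚ (ComplexPoints (fiberOver (univFamilyℂ 𝓜) t₁.1)) k),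
      (∃ δ₁ : Path.Homotopic.Quotient s t₁,
        ∀ v, ofRatClass _ k (T₁ v) = transportFun (univFamilyℂ 𝓜) k hU δ₁ (ofRatClass _ k v)) →
      ∀ p : ℤ, ∃ (r : ℕ)
        (w : Fin r → Set.Elem (Set.univ : Set (ComplexPoints ((Motives.baseChange ℚ ℂ).obj 𝓜.M))) →
          ℂ ⊗[ℚ] singularCohomology ℚ ℚ (ComplexPoints (fiberOver (univFamilyℂ 𝓜) s.1)) k),
        (∀ t ∈ W, ∀ (ε : Path t₁ t), (∀ r', ε r' ∈ W) →
          ∀ (T : singularCohomology ℚ ℚ (ComplexPoints (fiberOver (univFamilyℂ 𝓜) s.1)) k ≃ₗ[ℚ]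
            singularCohomology ℚ ℚ (ComplexPoints (fiberOver (univFamilyℂ 𝓜) t.1)) k),
          (∀ v, ofRatClass _ k (T v) = transportFun (univFamilyℂ 𝓜) k hU ⟦ε⟧ (ofRatClass _ k (T₁ v))) →
          LinearIndependent ℂ (fun i ↦ w i t) ∧
            (((A t.1).hodgeStructure
                ((isSmoothProjectiveFamily_univFamilyℂ_of_classify 𝓜).isSmoothProjective t.1)
                (hA t.1) k).comapEquiv T).F p =
              Submodule.span ℂ (Set.range fun i ↦ w i t)) ∧
        (∀ (i : Fin r)
          (φ : Module.Dual ℂ (ℂ ⊗[ℚ] singularCohomology ℚ ℚ (ComplexPoints (fiberOver (univFamilyℂ 𝓜) s.1)) k)),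
          AnalyticOnNhd ℂ (fun z ↦ φ (w i (ψ.symm z))) (ψ '' W)) := by
  have hXc : IsQuasiProjectiveOver ((Motives.baseChange ℚ ℂ).obj (univTotal 𝓜)) :=
    IsQuasiProjectiveOver.baseChangeHom (algebraMap ℚ ℂ) hXq
  exact griffiths1968_holomorphicHodgeSubbundlesQP_algebraicChart (univFamilyℂ 𝓜) k
    (isSmoothProjectiveFamily_univFamilyℂ_of_classify 𝓜) (isQuasiProjectiveOver_baseChange_M 𝓜 hMq) hXc hU A hA
    s t₁ N hN

/-- **Cohomological local triviality of the complexified universal family over all of `(M ⊗ ℂ)(ℂ)`** when `M ⊗ ℂ`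
is smooth of pure dimension `d` (discharges the binder `hU` of `exists_hodgeFrames_univFamilyℂ_algebraicChart`;
★ `isCohomologicallyLocallyTrivialOn_univ_of_isSmoothProjectiveFamily`). [cite: VoisinHodgeI2002, §9.2.1] -/
theorem isCohomologicallyLocallyTrivialOn_univFamilyℂ (hMq : IsQuasiProjectiveOver 𝓜.M) (d : ℕ)
    [AlgebraicGeometry.SmoothOfRelativeDimension d ((Motives.baseChange ℚ ℂ).obj 𝓜.M).hom] :
    IsCohomologicallyLocallyTrivialOn (univFamilyℂ 𝓜)
      (Set.univ : Set (ComplexPoints ((Motives.baseChange ℚ ℂ).obj 𝓜.M))) :=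
  isCohomologicallyLocallyTrivialOn_univ_of_isSmoothProjectiveFamily _ d
    (isSmoothProjectiveFamily_univFamilyℂ_of_classify 𝓜) (isQuasiProjectiveOver_baseChange_M 𝓜 hMq)

/-- **Hodge-symmetric Hodge models of the fibres of the complexified universal family exist** (discharges the binders
`A`/`hA` of `exists_hodgeFrames_univFamilyℂ_algebraicChart` up to a choice; ★ `exists_isReal_hodgeModel_holds` +
`HodgeModel.IsReal.isHodgeSymmetric`). [cite: VoisinHodgeI2002, §6.1.3 Prop. 6.11 and Cor. 6.12] -/
theorem exists_isHodgeSymmetric_hodgeModel_fiberOver_univFamilyℂ :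
    ∃ A : ∀ t : ComplexPoints ((Motives.baseChange ℚ ℂ).obj 𝓜.M), HodgeModel g (fiberOver (univFamilyℂ 𝓜) t),
      ∀ t, (A t).IsHodgeSymmetric := by
  have hf := isSmoothProjectiveFamily_univFamilyℂ_of_classify 𝓜
  have h : ∀ t : ComplexPoints ((Motives.baseChange ℚ ℂ).obj 𝓜.M),
      ∃ A : HodgeModel g (fiberOver (univFamilyℂ 𝓜) t), A.IsHodgeSymmetric := fun t ↦ by
    obtain ⟨A, hA⟩ := exists_isReal_hodgeModel_holds g _ (hf.isSmoothProjective t)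
    exact ⟨A, hA.isHodgeSymmetric⟩
  choose A hA using h
  exact ⟨A, hA⟩

end UnivFamilyHodgeFrames

end Summit.HodgeConjecture.HodgeConjecture.Theorems

end
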